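import Literature.AlgebraicGeometry.ComplexMultiplication.CMWeilSectionDichotomyFive
import HarnessLib

/-!
# Weil sections in total dimension five: a balanced `4`-subset of `⊔_i Hom(K_i, ℂ)` (`Σ_i [K_i:ℚ] = 10`, pair-rigid CM types)
# is a disjoint union of two balanced pairs or a Weil section of a coordinate fourfold

The combinatorial heart of Moonen–Zarhin 1999 Thm. 0.2 (i)–(iv) («B²(X) = D²(X) + Σ_α α^* B²(X′)» over fourfold quotients) for CM-product FIVEFOLDS: for CM fields `K_i` of total
degree `10`, PAIR-RIGID CM types `Φ_i` (a Galois-balanced pair inside one block is a conjugate pair) and a Galois-balanced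
`4`-subset `S` (a weight of bidegree `(2,2)`), either `S ∈ pohlmannDivisorSetsAlg Φ 2` (a disjoint union of two balanced
pairs — a product of divisor weights) or `S` misses exactly one conjugate pair `{x₀, ρx₀}` and every automorphism of `ℂ`
fixes that pair, i.e. `S` is a Weil section over the complementary coordinate fourfold
(`mem_pohlmannDivisorSetsAlg_two_or_weilSection_five`). The proof is the three-piece decomposition
`S = {s₂} ⊔ A ⊔ D`, `τ • S = {y₀} ⊔ A ⊔ ρ • D` for an automorphism `τ` moving the missing pair.

* Part 1 — from `CorCM/CMWeilSectionFivefold` (7/7 declarations; namespace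
  `Literature.AlgebraicGeometry.ComplexMultiplication.CMWeights`): Balanced `4`-weights on ten embeddings: the case
  analysis «fixed pair / moved pair» and the fivefold dichotomy. Declarations: `inv_smul_mem_pair`, `cover_smul`,
  `smul_finset_support_of_fixed_pair`, `exists_points_of_moved_pair`, `exists_decomposition_of_moved_pair`,
  `mem_pohlmannDivisorSetsAlg_two_of_moved_pair`, `mem_pohlmannDivisorSetsAlg_two_or_weilSection_five`.

## References

* [MoonenZarhin1999LowDim] B. Moonen, Yu. Zarhin, Math. Ann. 315 (1999) 711–733, Thm. 0.2 (i)–(iv) with (1.9) and §5 (5.12) (arXiv v2 = Math. Ann. numbering; MZ99 has no item (2.8), §2 ends with Thm. (2.7) — earlier tree copies wrote «(2.8)» for Thm. 0.2 (i)–(iv) read in codimension two).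
* [Gordon1999HodgeAVSurvey] B. B. Gordon, *A survey of the Hodge conjecture for abelian varieties*, §9.2, 9.2.2.

Provenance: Literature home of the used declarations of the Summits-side modules listed part by part above (cells
`pub-hodge-ring2` / `pub-hodgecm2`; namespaces `Summit.HodgeConjecture.CorCM.CMWeights` re-rooted under
`Literature.AlgebraicGeometry.…` as stated), whose imports are `Literature/` and Mathlib only for the declarations
used; re-homed verbatim (proofs unchanged) so that Literature users are served without importing `Summits/`. Lane
`lit-hodgefound`, seat p20 (generation 34). Theorems only: no definition, no named fact, no `sorry`; axioms `propext`,
`Classical.choice`, `Quot.sound`.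
-/

/-! ## Part 1: CMWeilSectionFivefold -/

noncomputable section

open NumberField

namespace Literature.AlgebraicGeometry.ComplexMultiplication.CMWeights

open Literature.AlgebraicGeometry.Motives (CMType)
open Literature.AlgebraicGeometry.Pohlmann1968
open Literature.NumberTheory.ComplexMultiplication

open scoped Classical Pointwise

variable {n : ℕ} {K : Fin n → Type} [∀ i, Field (K i)] [∀ i, NumberField (K i)] [∀ i, IsCMField (K i)]

/-! ### §1 Transport of the covering property -/

/-- If `τ` fixes the pair `{x₀, ρ x₀}` then so does `τ⁻¹`. [cite: MoonenZarhin1999LowDim, Thm. 0.2 (i)–(iv) with (1.9)] -/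
theorem inv_smul_mem_pair {x₀ : (i : Fin n) × (K i →+* ℂ)} {τ : ℂ ≃+* ℂ}
    (hτ : τ • x₀ = x₀ ∨ τ • x₀ = (starRingAut : ℂ ≃+* ℂ) • x₀) : τ⁻¹ • x₀ = x₀ ∨ τ⁻¹ • x₀ = (starRingAut : ℂ ≃+* ℂ) • x₀ := by
  rcases hτ with h | h
  · left; conv_lhs => rw [← h]
    rw [inv_smul_smul]
  · right
    have h1 : τ⁻¹ • (τ • x₀) = τ⁻¹ • (starRingAut : ℂ ≃+* ℂ) • x₀ := by rw [h]
    rw [inv_smul_smul, smul_conj_smul_comm] at h1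
    have h2 := congrArg (fun z => (starRingAut : ℂ ≃+* ℂ) • z) h1
    simp only [conj_smul_conj_smul] at h2
    exact h2.symm

/-- The covering property `x ∈ S ∨ ρx ∈ S ∨ x ∈ {x₀, ρ x₀}` transported by `τ`: every `x` lies in `τ • S`, or has its
conjugate there, or lies in the pair `{τ x₀, ρ τ x₀}`. [cite: MoonenZarhin1999LowDim, Thm. 0.2 (i)–(iv) with (1.9)] -/
theorem cover_smul {S : Finset ((i : Fin n) × (K i →+* ℂ))} {x₀ : (i : Fin n) × (K i →+* ℂ)}
    (hcov : ∀ x : (i : Fin n) × (K i →+* ℂ), x ∈ S ∨ (starRingAut : ℂ ≃+* ℂ) • x ∈ S ∨ x = x₀ ∨ x = (starRingAut : ℂ ≃+* ℂ) • x₀)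
    (τ : ℂ ≃+* ℂ) (x : (i : Fin n) × (K i →+* ℂ)) :
    x ∈ τ • S ∨ (starRingAut : ℂ ≃+* ℂ) • x ∈ τ • S ∨ x = τ • x₀ ∨ x = (starRingAut : ℂ ≃+* ℂ) • τ • x₀ := by
  rcases hcov (τ⁻¹ • x) with h | h | h | h
  · exact Or.inl (Finset.inv_smul_mem_iff.1 h)
  · refine Or.inr (Or.inl ?_)
    rw [← smul_conj_smul_comm] at h
    exact Finset.inv_smul_mem_iff.1 h
  · refine Or.inr (Or.inr (Or.inl ?_))
    rw [← h, smul_inv_smul]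
  · refine Or.inr (Or.inr (Or.inr ?_))
    rw [← smul_conj_smul_comm, ← h, smul_inv_smul]

/-! ### §2 A fixed pair: `τ • S` lies over the support of `S` -/

/-- **If `τ` fixes the missing pair, `τ • S` and `S` lie over the same conjugate pairs.**  For `S` disjoint from
`{x₀, ρ x₀}` and covering the rest (`hcov`), and `τ x₀ ∈ {x₀, ρ x₀}`: every member of `τ • S` is in `S` up to
conjugation and conversely. [cite: MoonenZarhin1999LowDim, Thm. 0.2 (i)–(iv) with (1.9)] -/
theorem smul_finset_support_of_fixed_pair {S : Finset ((i : Fin n) × (K i →+* ℂ))}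
    {x₀ : (i : Fin n) × (K i →+* ℂ)} (hx₀ : x₀ ∉ S) (hx₀' : (starRingAut : ℂ ≃+* ℂ) • x₀ ∉ S)
    (hcov : ∀ x : (i : Fin n) × (K i →+* ℂ), x ∈ S ∨ (starRingAut : ℂ ≃+* ℂ) • x ∈ S ∨ x = x₀ ∨ x = (starRingAut : ℂ ≃+* ℂ) • x₀)
    {τ : ℂ ≃+* ℂ} (hτ : τ • x₀ = x₀ ∨ τ • x₀ = (starRingAut : ℂ ≃+* ℂ) • x₀) :
    (∀ x ∈ τ • S, x ∈ S ∨ (starRingAut : ℂ ≃+* ℂ) • x ∈ S) ∧ (∀ y ∈ S, y ∈ τ • S ∨ (starRingAut : ℂ ≃+* ℂ) • y ∈ τ • S) := by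
  have hτ' := inv_smul_mem_pair hτ
  have key : ∀ y ∈ S, ¬ (y = τ • x₀ ∨ y = (starRingAut : ℂ ≃+* ℂ) • τ • x₀) := by
    rintro y hy (rfl | rfl)
    · rcases hτ with h | h
      · exact hx₀ (h ▸ hy)
      · exact hx₀' (h ▸ hy)
    · rcases hτ with h | h
      · rw [h] at hy; exact hx₀' hy
      · rw [h, conj_smul_conj_smul] at hy; exact hx₀ hy
  have key' : ∀ y ∈ S, ¬ (y = τ⁻¹ • x₀ ∨ y = (starRingAut : ℂ ≃+* ℂ) • τ⁻¹ • x₀) := by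
    rintro y hy (rfl | rfl)
    · rcases hτ' with h | h
      · exact hx₀ (h ▸ hy)
      · exact hx₀' (h ▸ hy)
    · rcases hτ' with h | h
      · rw [h] at hy; exact hx₀' hy
      · rw [h, conj_smul_conj_smul] at hy; exact hx₀ hy
  constructor
  · intro x hx
    rcases hcov x with h | h | h | h
    · exact Or.inl h
    · exact Or.inr h
    · exfalso
      obtain ⟨y, hy, rfl⟩ := Finset.mem_smul_finset.1 hx
      refine key' y hy (Or.inl ?_)
      rw [← h, inv_smul_smul]
    · exfalso
      obtain ⟨y, hy, rfl⟩ := Finset.mem_smul_finset.1 hx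
      refine key' y hy (Or.inr ?_)
      rw [← smul_conj_smul_comm, ← h, inv_smul_smul]
  · intro y hy
    rcases cover_smul hcov τ y with h | h | h | h
    exacts [Or.inl h, Or.inr h, absurd (Or.inl h) (key y hy), absurd (Or.inr h) (key y hy)]

/-! ### §3 A moved pair: the points `s₂ ∈ S ∩ τ P₀`, `y₀ ∈ τS ∩ P₀` and the three-piece decomposition -/

/-- If `τ` moves the missing pair `P₀ = {x₀, ρ x₀}`, then `S` has a point `s₂` over `τ P₀` and `τ • S` has a point
`y₀` over `P₀`. [cite: MoonenZarhin1999LowDim, Thm. 0.2 (i)–(iv) with (1.9)] -/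
theorem exists_points_of_moved_pair {S : Finset ((i : Fin n) × (K i →+* ℂ))} {x₀ : (i : Fin n) × (K i →+* ℂ)}
    (hcov : ∀ x : (i : Fin n) × (K i →+* ℂ), x ∈ S ∨ (starRingAut : ℂ ≃+* ℂ) • x ∈ S ∨ x = x₀ ∨ x = (starRingAut : ℂ ≃+* ℂ) • x₀)
    {τ : ℂ ≃+* ℂ} (hτ : ¬ (τ • x₀ = x₀ ∨ τ • x₀ = (starRingAut : ℂ ≃+* ℂ) • x₀)) :
    (∃ s₂ ∈ S, s₂ = τ • x₀ ∨ s₂ = (starRingAut : ℂ ≃+* ℂ) • τ • x₀) ∧ ∃ y₀ ∈ τ • S, y₀ = x₀ ∨ y₀ = (starRingAut : ℂ ≃+* ℂ) • x₀ := by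
  constructor
  · rcases hcov (τ • x₀) with h | h | h | h
    exacts [⟨_, h, Or.inl rfl⟩, ⟨_, h, Or.inr rfl⟩, absurd (Or.inl h) hτ, absurd (Or.inr h) hτ]
  · rcases hcov (τ⁻¹ • x₀) with h | h | h | h
    · exact ⟨x₀, Finset.inv_smul_mem_iff.1 h, Or.inl rfl⟩
    · refine ⟨(starRingAut : ℂ ≃+* ℂ) • x₀, ?_, Or.inr rfl⟩
      rw [← smul_conj_smul_comm] at h
      exact Finset.inv_smul_mem_iff.1 h
    · exfalso
      refine hτ (Or.inl ?_)
      have h' : τ • τ⁻¹ • x₀ = τ • x₀ := by rw [h]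
      rw [smul_inv_smul] at h'
      exact h'.symm
    · exfalso
      refine hτ (Or.inr ?_)
      have h' : τ • τ⁻¹ • x₀ = τ • (starRingAut : ℂ ≃+* ℂ) • x₀ := by rw [h]
      rw [smul_inv_smul, smul_conj_smul_comm] at h'
      have h'' := congrArg (fun z => (starRingAut : ℂ ≃+* ℂ) • z) h'
      simp only [conj_smul_conj_smul] at h''
      exact h''.symm

/-- **The three-piece decomposition for a moved pair.**  With `s₂ ∈ S` over `τ P₀` and `y₀ ∈ τ • S` over `P₀`:
`S = {s₂} ⊔ A ⊔ D` and `τ • S = {y₀} ⊔ A ⊔ ρ • D` with `A = (S ∖ s₂) ∩ (τS ∖ y₀)`, `D = (S ∖ s₂) ∖ (τS ∖ y₀)`,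
`|A| + |D| = 3` (off the two pairs `P₀`, `τ P₀` both weights are sections over the same three pairs). [cite: MoonenZarhin1999LowDim, Thm. 0.2 (i)–(iv) with (1.9)] -/
theorem exists_decomposition_of_moved_pair {S : Finset ((i : Fin n) × (K i →+* ℂ))} (hS4 : S.card = 4)
    (hsec : ∀ x ∈ S, (starRingAut : ℂ ≃+* ℂ) • x ∉ S) {x₀ : (i : Fin n) × (K i →+* ℂ)} (hx₀ : x₀ ∉ S) (hx₀' : (starRingAut : ℂ ≃+* ℂ) • x₀ ∉ S)
    (hcov : ∀ x : (i : Fin n) × (K i →+* ℂ), x ∈ S ∨ (starRingAut : ℂ ≃+* ℂ) • x ∈ S ∨ x = x₀ ∨ x = (starRingAut : ℂ ≃+* ℂ) • x₀)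
    {τ : ℂ ≃+* ℂ} {s₂ y₀ : (i : Fin n) × (K i →+* ℂ)} (hs₂S : s₂ ∈ S) (hs₂P : s₂ = τ • x₀ ∨ s₂ = (starRingAut : ℂ ≃+* ℂ) • τ • x₀)
    (hy₀S : y₀ ∈ τ • S) (hy₀P : y₀ = x₀ ∨ y₀ = (starRingAut : ℂ ≃+* ℂ) • x₀) :
    ∃ A D : Finset ((i : Fin n) × (K i →+* ℂ)), S = {s₂} ∪ (A ∪ D) ∧ τ • S = {y₀} ∪ (A ∪ (starRingAut : ℂ ≃+* ℂ) • D) ∧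
      Disjoint ({s₂} : Finset _) (A ∪ D) ∧ Disjoint ({y₀} : Finset _) (A ∪ (starRingAut : ℂ ≃+* ℂ) • D) ∧ Disjoint A D ∧
      Disjoint A ((starRingAut : ℂ ≃+* ℂ) • D) ∧ A.card + D.card = 3 := by
  have hS'sec : ∀ x ∈ τ • S, (starRingAut : ℂ ≃+* ℂ) • x ∉ τ • S := forall_conj_smul_not_mem_smul_finset hsec τ
  have hy₀notS : y₀ ∉ S := fun h => by
    rcases hy₀P with rfl | rfl
    · exact hx₀ h
    · exact hx₀' h
  have hρy₀notS : (starRingAut : ℂ ≃+* ℂ) • y₀ ∉ S := fun h => by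
    rcases hy₀P with rfl | rfl
    · exact hx₀' h
    · rw [conj_smul_conj_smul] at h; exact hx₀ h
  have f2 : ∀ y ∈ S, (y = τ • x₀ ∨ y = (starRingAut : ℂ ≃+* ℂ) • τ • x₀) → y = s₂ := by
    intro y hy hyP
    rcases hyP with rfl | rfl <;> rcases hs₂P with h | h
    · exact h.symm
    · exact absurd (h ▸ hs₂S) (hsec _ hy)
    · refine absurd ?_ (hsec _ hs₂S)
      rw [h]; exact hy
    · exact h.symm
  have f3 : ∀ x ∈ τ • S, ¬ (x = τ • x₀ ∨ x = (starRingAut : ℂ ≃+* ℂ) • τ • x₀) := by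
    intro x hx hxP
    obtain ⟨y, hy, rfl⟩ := Finset.mem_smul_finset.1 hx
    rcases hxP with h | h
    · exact hx₀ (MulAction.injective τ h ▸ hy)
    · rw [← smul_conj_smul_comm] at h
      exact hx₀' (MulAction.injective τ h ▸ hy)
  have f4 : ∀ x ∈ τ • S, (x = x₀ ∨ x = (starRingAut : ℂ ≃+* ℂ) • x₀) → x = y₀ := by
    intro x hx hxP
    rcases hxP with rfl | rfl <;> rcases hy₀P with h | h
    · exact h.symm
    · exact absurd (h ▸ hy₀S) (hS'sec _ hx)
    · refine absurd ?_ (hS'sec _ hy₀S)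
      rw [h]; exact hx
    · exact h.symm
  have f5 := cover_smul hcov τ
  refine ⟨(S.erase s₂) ∩ ((τ • S).erase y₀), (S.erase s₂) \ ((τ • S).erase y₀), ?_, ?_, ?_, ?_, ?_, ?_, ?_⟩
  · -- `S = {s₂} ⊔ (A ⊔ D)`
    rw [Finset.union_comm (S.erase s₂ ∩ _), Finset.sdiff_union_inter, ← Finset.insert_eq, Finset.insert_erase hs₂S]
  · -- `τ • S = {y₀} ⊔ (A ⊔ (starRingAut : ℂ ≃+* ℂ) • D)`
    ext x
    simp only [Finset.mem_union, Finset.mem_singleton, Finset.mem_inter, Finset.mem_erase, Finset.mem_sdiff,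
      not_and, Finset.mem_smul_finset (s := S.erase s₂ \ (τ • S).erase y₀)]
    constructor
    · intro hx
      by_cases hxy : x = y₀
      · exact Or.inl hxy
      right
      have hxP₀ : ¬ (x = x₀ ∨ x = (starRingAut : ℂ ≃+* ℂ) • x₀) := fun h => hxy (f4 x hx h)
      rcases hcov x with h | h | h | h
      · left
        have hxs₂ : x ≠ s₂ := by rintro rfl; exact f3 _ hx hs₂P
        exact ⟨⟨hxs₂, h⟩, hxy, hx⟩
      · right
        have hρxs₂ : (starRingAut : ℂ ≃+* ℂ) • x ≠ s₂ := by
          intro h'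
          refine f3 x hx ?_
          rcases hs₂P with h2 | h2
          · right; rw [← h2, ← h', conj_smul_conj_smul]
          · left
            have e := congrArg (fun z => (starRingAut : ℂ ≃+* ℂ) • z) (h'.trans h2)
            simp only [conj_smul_conj_smul] at e
            exact e
        exact ⟨(starRingAut : ℂ ≃+* ℂ) • x, ⟨⟨hρxs₂, h⟩, fun _ => hS'sec x hx⟩, conj_smul_conj_smul x⟩
      · exact absurd (Or.inl h) hxP₀
      · exact absurd (Or.inr h) hxP₀
    · rintro (rfl | ⟨⟨-, -⟩, -, hx⟩ | ⟨d, hd, rfl⟩)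
      · exact hy₀S
      · exact hx
      · obtain ⟨⟨hds₂, hdS⟩, hdT'⟩ := hd
        have hdτ : d ∉ τ • S := fun h => hdT' (fun h' => hy₀notS (h' ▸ hdS)) h
        rcases f5 d with h | h | h | h
        exacts [absurd h hdτ, h, absurd (f2 d hdS (Or.inl h)) hds₂, absurd (f2 d hdS (Or.inr h)) hds₂]
  · rw [Finset.union_comm (S.erase s₂ ∩ _), Finset.sdiff_union_inter, Finset.disjoint_singleton_left]
    exact Finset.notMem_erase s₂ S
  · rw [Finset.disjoint_singleton_left, Finset.mem_union, not_or, Finset.mem_inter, not_and]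
    refine ⟨fun _ h => Finset.notMem_erase y₀ (τ • S) h, fun h => ?_⟩
    obtain ⟨d, hd, hdy⟩ := Finset.mem_smul_finset.1 h
    have hd' : d = (starRingAut : ℂ ≃+* ℂ) • y₀ := by rw [← hdy, conj_smul_conj_smul]
    have hdS : d ∈ S := Finset.mem_of_mem_erase (Finset.mem_sdiff.1 hd).1
    exact hρy₀notS (hd' ▸ hdS)
  · exact Finset.disjoint_left.2 fun x hx hx' => (Finset.mem_sdiff.1 hx').2 (Finset.mem_inter.1 hx).2
  · rw [Finset.disjoint_left]
    intro x hxA hx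
    obtain ⟨d, hd, rfl⟩ := Finset.mem_smul_finset.1 hx
    exact hsec d (Finset.mem_of_mem_erase (Finset.mem_sdiff.1 hd).1)
      (Finset.mem_of_mem_erase (Finset.mem_inter.1 hxA).1)
  · rw [← Finset.card_union_of_disjoint
      (Finset.disjoint_left.2 fun x hx hx' => (Finset.mem_sdiff.1 hx').2 (Finset.mem_inter.1 hx).2),
      Finset.union_comm, Finset.sdiff_union_inter, Finset.card_erase_of_mem hs₂S, hS4]

/-- **If some `τ` moves the missing pair, `S` is a disjoint union of two balanced pairs** — for PAIR-RIGID types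
(`hrig`: a balanced pair inside one block is a conjugate pair): the three-piece count on the decomposition of
`exists_decomposition_of_moved_pair` splits `S` when `|D| ∈ {1, 2}`, and for `|D| ∈ {0, 3}` yields a balanced
non-conjugate pair `{s₂, ρ y₀}` resp. `{s₂, y₀}` inside the block of `x₀`, which rigidity excludes. [cite: MoonenZarhin1999LowDim, Thm. 0.2 (i)–(iv) with (1.9)] -/
theorem mem_pohlmannDivisorSetsAlg_two_of_moved_pair (Φ : ∀ i, CMType (K i))
    (hrig : ∀ x y : (i : Fin n) × (K i →+* ℂ), x.1 = y.1 → x ≠ y →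
      IsGaloisBalancedAlg Φ ({x} ∪ ({y} : Finset _)) → y = (starRingAut : ℂ ≃+* ℂ) • x)
    {S : Finset ((i : Fin n) × (K i →+* ℂ))} (hS : S ∈ pohlmannSetsAlg Φ 2) (hsec : ∀ x ∈ S, (starRingAut : ℂ ≃+* ℂ) • x ∉ S)
    {x₀ : (i : Fin n) × (K i →+* ℂ)} (hx₀ : x₀ ∉ S) (hx₀' : (starRingAut : ℂ ≃+* ℂ) • x₀ ∉ S)
    (hcov : ∀ x : (i : Fin n) × (K i →+* ℂ), x ∈ S ∨ (starRingAut : ℂ ≃+* ℂ) • x ∈ S ∨ x = x₀ ∨ x = (starRingAut : ℂ ≃+* ℂ) • x₀)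
    {τ : ℂ ≃+* ℂ} (hτ : ¬ (τ • x₀ = x₀ ∨ τ • x₀ = (starRingAut : ℂ ≃+* ℂ) • x₀)) : S ∈ pohlmannDivisorSetsAlg Φ 2 := by
  have hS4 : S.card = 4 := hS.1
  obtain ⟨⟨s₂, hs₂S, hs₂P⟩, y₀, hy₀S, hy₀P⟩ := exists_points_of_moved_pair hcov hτ
  obtain ⟨A, D, hSeq, hS'eq, hs₂d, hy₀d, hAD, hAD', hcard⟩ :=
    exists_decomposition_of_moved_pair hS4 hsec hx₀ hx₀' hcov hs₂S hs₂P hy₀S hy₀P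
  obtain ⟨c1, c2, c3, c4⟩ := isGaloisBalancedAlg_of_moved_pair Φ hS.2 hSeq hS'eq hs₂d hy₀d hAD hAD'
  have hy₀notS : y₀ ∉ S := fun h => by
    rcases hy₀P with rfl | rfl
    · exact hx₀ h
    · exact hx₀' h
  have hρy₀notS : (starRingAut : ℂ ≃+* ℂ) • y₀ ∉ S := fun h => by
    rcases hy₀P with rfl | rfl
    · exact hx₀' h
    · rw [conj_smul_conj_smul] at h; exact hx₀ h
  -- all four points lie in the block of `x₀`
  have hs₂1 : s₂.1 = x₀.1 := by rcases hs₂P with rfl | rfl <;> rfl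
  have hy₀1 : y₀.1 = x₀.1 := by rcases hy₀P with rfl | rfl <;> rfl
  obtain h0 | h1 | h2 | h3 : D.card = 0 ∨ D.card = 1 ∨ D.card = 2 ∨ D.card = 3 := by omega
  · -- `|D| = 0`: `{s₂, ρ y₀}` balanced, not conjugate
    exfalso
    have hne : s₂ ≠ (starRingAut : ℂ ≃+* ℂ) • y₀ := fun h => hρy₀notS (h ▸ hs₂S)
    have hd : Disjoint ({s₂} : Finset _) ((starRingAut : ℂ ≃+* ℂ) • ({y₀} : Finset _)) := by
      rw [Finset.smul_finset_singleton, Finset.disjoint_singleton_left, Finset.mem_singleton]; exact hne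
    have hpair := c3 h0 hd
    rw [Finset.smul_finset_singleton] at hpair
    have h := hrig s₂ ((starRingAut : ℂ ≃+* ℂ) • y₀) (by rw [hs₂1, smul_sigma_fst, hy₀1]) hne hpair
    exact hy₀notS ((MulAction.injective (starRingAut : ℂ ≃+* ℂ) h) ▸ hs₂S)
  · -- `|D| = 1`, `|A| = 2`: `S = A ⊔ ({s₂} ⊔ D)`
    have hA2 : A.card = 2 := by omega
    have hAbal := c1 hA2 h1
    have hSeq' : S = A ∪ ({s₂} ∪ D) := hSeq.trans (Finset.union_left_comm _ _ _)
    have hdisj : Disjoint A ({s₂} ∪ D) :=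
      Finset.disjoint_union_right.2 ⟨(Finset.disjoint_union_right.1 hs₂d).1.symm, hAD⟩
    have hrest := isGaloisBalancedAlg_of_union_left (hSeq' ▸ hS.2) hAbal hdisj
    exact mem_pohlmannDivisorSetsAlg_two_of_split hS4 (by rw [← Finset.card_pos, hA2]; norm_num)
      ⟨s₂, Finset.mem_union_left _ (Finset.mem_singleton_self _)⟩ hdisj hSeq' hAbal hrest
  · -- `|D| = 2`, `|A| = 1`: `S = D ⊔ ({s₂} ⊔ A)`
    have hA1 : A.card = 1 := by omega
    have hDbal := c2 hA1 h2
    have hSeq' : S = D ∪ ({s₂} ∪ A) := hSeq.trans (by rw [Finset.union_comm A D, Finset.union_left_comm])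
    have hdisj : Disjoint D ({s₂} ∪ A) :=
      Finset.disjoint_union_right.2 ⟨(Finset.disjoint_union_right.1 hs₂d).2.symm, hAD.symm⟩
    have hrest := isGaloisBalancedAlg_of_union_left (hSeq' ▸ hS.2) hDbal hdisj
    exact mem_pohlmannDivisorSetsAlg_two_of_split hS4 (by rw [← Finset.card_pos, h2]; norm_num)
      ⟨s₂, Finset.mem_union_left _ (Finset.mem_singleton_self _)⟩ hdisj hSeq' hDbal hrest
  · -- `|D| = 3`, `|A| = 0`: `{s₂, y₀}` balanced, not conjugate
    exfalso
    have hne : s₂ ≠ y₀ := fun h => hy₀notS (h ▸ hs₂S)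
    have hd : Disjoint ({s₂} : Finset _) ({y₀} : Finset _) := by
      rw [Finset.disjoint_singleton_left, Finset.mem_singleton]; exact hne
    have hpair := c4 (by omega) hd
    have h := hrig s₂ y₀ (hs₂1.trans hy₀1.symm) hne hpair
    have e : (starRingAut : ℂ ≃+* ℂ) • y₀ = s₂ := by rw [h, conj_smul_conj_smul]
    exact hρy₀notS (e ▸ hs₂S)

/-! ### §4 The fivefold dichotomy -/

/-- **Divisor pairs or a Weil section of a coordinate fourfold (total dimension `5`).**  For CM fields with
`Σ_i [K_i:ℚ] = 10`, PAIR-RIGID CM types `Φ_i` (a balanced pair inside one block is a conjugate pair), and a balanced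
`4`-subset `S` of `⊔_i Hom(K_i, ℂ)`: EITHER `S` is a disjoint union of two balanced pairs (the index of a product of
two divisor classes), OR `S` is antipodal-free, misses exactly one conjugate pair `{x₀, ρ x₀}`, that pair is STABLE
under `Aut(ℂ)` (so the block of `x₀` is an imaginary quadratic field — a CM elliptic curve factor), and
`τ • S ∈ {S, ρ • S}` for every `τ ∈ Aut(ℂ)` — the index of a Weil class pulled back from the complementary
coordinate fourfold.  The combinatorial content of the CM slice of Moonen–Zarhin's Thm. 0.2.
[cite: MoonenZarhin1999LowDim, Thm. 0.2 (i)–(iv) with (1.9)] -/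
theorem mem_pohlmannDivisorSetsAlg_two_or_weilSection_five (hK : ∑ i, Module.finrank ℚ (K i) = 10)
    (Φ : ∀ i, CMType (K i))
    (hrig : ∀ x y : (i : Fin n) × (K i →+* ℂ), x.1 = y.1 → x ≠ y →
      IsGaloisBalancedAlg Φ ({x} ∪ ({y} : Finset _)) → y = (starRingAut : ℂ ≃+* ℂ) • x)
    {S : Finset ((i : Fin n) × (K i →+* ℂ))} (hS : S ∈ pohlmannSetsAlg Φ 2) :
    S ∈ pohlmannDivisorSetsAlg Φ 2 ∨
    ((∀ x ∈ S, (starRingAut : ℂ ≃+* ℂ) • x ∉ S) ∧ ∃ x₀ : (i : Fin n) × (K i →+* ℂ), x₀ ∉ S ∧ (starRingAut : ℂ ≃+* ℂ) • x₀ ∉ S ∧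
      (∀ x : (i : Fin n) × (K i →+* ℂ), x ∈ S ∨ (starRingAut : ℂ ≃+* ℂ) • x ∈ S ∨ x = x₀ ∨ x = (starRingAut : ℂ ≃+* ℂ) • x₀) ∧
      ∀ τ : ℂ ≃+* ℂ, (τ • x₀ = x₀ ∨ τ • x₀ = (starRingAut : ℂ ≃+* ℂ) • x₀) ∧ (τ • S = S ∨ τ • S = (starRingAut : ℂ ≃+* ℂ) • S)) := by
  by_cases hpair : ∃ x ∈ S, (starRingAut : ℂ ≃+* ℂ) • x ∈ S
  · obtain ⟨x, hx, hx'⟩ := hpair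
    exact Or.inl (mem_pohlmannDivisorSetsAlg_two_of_conj_smul_mem hS hx hx')
  have hsec : ∀ x ∈ S, (starRingAut : ℂ ≃+* ℂ) • x ∉ S := fun x hx hx' => hpair ⟨x, hx, hx'⟩
  by_cases hD : S ∈ pohlmannDivisorSetsAlg Φ 2
  · exact Or.inl hD
  right
  have hS4 : S.card = 4 := hS.1
  have hdisj : Disjoint S ((starRingAut : ℂ ≃+* ℂ) • S) := by
    rw [Finset.disjoint_left]
    intro y hy hy'
    obtain ⟨z, hz, rfl⟩ := Finset.mem_smul_finset.1 hy'
    exact hsec z hz hy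
  have h8 : (S ∪ (starRingAut : ℂ ≃+* ℂ) • S).card = 8 := by rw [Finset.card_union_of_disjoint hdisj, Finset.card_smul_finset, hS4]
  have h10 : Fintype.card ((i : Fin n) × (K i →+* ℂ)) = 10 := by rw [card_sigma_ringHom_complex, hK]
  have hx₀ex : ∃ x₀ : (i : Fin n) × (K i →+* ℂ), x₀ ∉ S ∪ (starRingAut : ℂ ≃+* ℂ) • S := by
    by_contra h
    simp only [not_exists, not_not] at h
    have hU : S ∪ (starRingAut : ℂ ≃+* ℂ) • S = Finset.univ := Finset.eq_univ_iff_forall.2 h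
    rw [hU, Finset.card_univ, h10] at h8
    norm_num at h8
  obtain ⟨x₀, hx₀u⟩ := hx₀ex
  rw [Finset.mem_union, not_or] at hx₀u
  have hx₀ : x₀ ∉ S := hx₀u.1
  have hx₀' : (starRingAut : ℂ ≃+* ℂ) • x₀ ∉ S := by rw [← conj_inv_smul, Finset.inv_smul_mem_iff]; exact hx₀u.2
  have hne₀ : x₀ ≠ (starRingAut : ℂ ≃+* ℂ) • x₀ := fun h => conj_smul_ne_self Φ x₀ h.symm
  have hcov : ∀ x : (i : Fin n) × (K i →+* ℂ), x ∈ S ∨ (starRingAut : ℂ ≃+* ℂ) • x ∈ S ∨ x = x₀ ∨ x = (starRingAut : ℂ ≃+* ℂ) • x₀ := by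
    have hd2 : Disjoint (S ∪ (starRingAut : ℂ ≃+* ℂ) • S) ({x₀} ∪ ({(starRingAut : ℂ ≃+* ℂ) • x₀} : Finset _)) := by
      rw [Finset.disjoint_union_right, Finset.disjoint_singleton_right, Finset.disjoint_singleton_right,
        Finset.mem_union, Finset.mem_union, not_or, not_or]
      refine ⟨⟨hx₀, hx₀u.2⟩, hx₀', ?_⟩
      rw [Finset.smul_mem_smul_finset_iff]; exact hx₀
    have hd3 : Disjoint ({x₀} : Finset _) ({(starRingAut : ℂ ≃+* ℂ) • x₀} : Finset _) := by
      rw [Finset.disjoint_singleton_left, Finset.mem_singleton]; exact hne₀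
    have hcardU : (S ∪ (starRingAut : ℂ ≃+* ℂ) • S ∪ ({x₀} ∪ {(starRingAut : ℂ ≃+* ℂ) • x₀})).card = Fintype.card ((i : Fin n) × (K i →+* ℂ)) := by
      rw [Finset.card_union_of_disjoint hd2, h8, Finset.card_union_of_disjoint hd3, Finset.card_singleton,
        Finset.card_singleton, h10]
    have huniv := Finset.eq_univ_of_card _ hcardU
    intro x
    have hx : x ∈ S ∪ (starRingAut : ℂ ≃+* ℂ) • S ∪ ({x₀} ∪ {(starRingAut : ℂ ≃+* ℂ) • x₀}) := huniv ▸ Finset.mem_univ x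
    simp only [Finset.mem_union, Finset.mem_singleton] at hx
    rcases hx with (h | h) | h | h
    · exact Or.inl h
    · right; left
      rw [← Finset.inv_smul_mem_iff, conj_inv_smul] at h
      exact h
    · exact Or.inr (Or.inr (Or.inl h))
    · exact Or.inr (Or.inr (Or.inr h))
  refine ⟨hsec, x₀, hx₀, hx₀', hcov, fun τ => ?_⟩
  have hA : τ • x₀ = x₀ ∨ τ • x₀ = (starRingAut : ℂ ≃+* ℂ) • x₀ := by
    by_contra hB
    exact hD (mem_pohlmannDivisorSetsAlg_two_of_moved_pair Φ hrig hS hsec hx₀ hx₀' hcov hB)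
  refine ⟨hA, ?_⟩
  obtain ⟨h1, h2⟩ := smul_finset_support_of_fixed_pair hx₀ hx₀' hcov hA
  rcases section_dichotomy_of_support Φ hS.2 hsec τ h1 h2 with h | h | ⟨A, D, hAne, hDne, hAD, hSAD, hA', hD'⟩
  · exact Or.inl h
  · exact Or.inr h
  · exact absurd (mem_pohlmannDivisorSetsAlg_two_of_split hS4 hAne hDne hAD hSAD hA' hD') hD

end Literature.AlgebraicGeometry.ComplexMultiplication.CMWeights

end
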